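import Summits.QuantumFields.YangMills.Theorems.BalabanUVNodesN11AtRecord12C

/-!
# DAG node N11 — [B14]'s Theorem p. 245 at NODE 00's Stage-12 record: ITS SLOTS ARE CONTENTFUL AT EVERY TUPLE WITH PROVISOS, and
# THE DEGENERATE-𝐓-WEIGHT SPECIES (S3) IN KERNEL — why item K1′'s guard `θ.ZtUnity` is load-bearing for N11 (and for N13's 𝐑-leaf)

Cell `pub-ymgap`, YM-PLAN Track A (HUMAN RULING D-0062), seat `pub-ymgap-dag-n11-d` (g2; R134 fan-out seat N11 [B14], strategy s2), route
`BalabanUVNodes` rev 15, item K1′ `StabilityBAtRecordR12e` = stmt-QuantumFields-19903 (registered stub `stub_nodes12`: N01–N13 at SOME Stage-12 tuple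
`θ` with `θ.Provisos₁₂ ∧ (θ.ZtUnity ∧ θ.SlotsNondegenerate) ∧ θ.Admissible`).  [III] = [Balaban1988Convergent], [I] = [Balaban1987RG1].
Sequel of this seat's `BalabanUVNodesN11AtRecord12C` (p459309): there N11 at a Stage-12 world was reduced BY NAME to ONE displayed slot, (S1ᵀ)
«`∀ k < K, SLaw₁₂ θ P k → TLaw₁₂ θ P k`» = [III]'s Theorem of p. 245 at the objects of record (`SLaw₁₂`∕`TLaw₁₂`: the REPAIRED §2 form of the
post-𝐑 ∕ pre-𝐑 slot families of record, whole-slot dichotomy «slot absent (`= 0`) OR the (2.18) identity a.e. on the χ-support», `Node00/Record12`).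

WHY THIS FILE.  The tribunal's question for every (B)-side slot at the re-pinned record (dag-ref-H `Record12` SWEEP (S3); director-ym LINES №104 ∕ №108 ∕
№109: «is the slot CONTENTFUL at θ, or closable by a vacuity species?») is answered IN KERNEL for N11's slot, at EVERY Stage-12 tuple carrying its
provisos (not only at the K0′-components' residuals of record — the K1′ prover chooses its witness `θ` freely):
(1) NON-VACUITY.  Along every run `P`, the densities of record `ρ_j` (`j ≤ K`) and their 𝐓-images `𝐓ρ_k` (`k < K`) have total integral `∫ρ₀ > 0` ((0.4) +
the push-forward identity at `f ≡ 1` — the tower's displayed faces; `ρ₀ = e^{−E}·exp(−A∕g₀²) > 0` on a probability space), and each IS the χ-weighted sum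
of its slot family (`rfl`); hence SOME slot of each family is NON-NULL ON ITS OWN χ-SUPPORT (§2), so `SLaw₁₂ θ P j` ∕ `TLaw₁₂ θ P k` — when they hold — hold
through the IDENTITY branch on a non-null set (§3): [III]'s (2.18)∕(3.25) identities with law-abiding universal terms are GENUINELY demanded; the zero
branch of 12b's dichotomy never discharges a whole level (K0b's `Record12ResidualsSlots`: the level-1 pre-𝐑 instance at the residuals of record).
(2) THE (S3) SPECIES.  If the residual 𝐓-weight factor `ζ0` of `θ` VANISHES AT GENERATION 0 on the run's torus (its proviso clauses are only `ζ0 ≥ 0` and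
locality), then 11a's `𝐓_{k+1}(s)` of record is the ZERO operator at every positive level (its innermost generation multiplies by `ζ_0 = ζ0·χreg = 0`, later
generations transport and integrate the zero function), so EVERY §2-form slot `𝐓_{k+1}(s) exp A_{k+1}(s)` is the zero density (§4); with (1): `SLaw₁₂ θ P j`
is FALSE for `1 ≤ j ≤ K` and `TLaw₁₂ θ P k` is FALSE for every `k < K`.  CONSEQUENCES at such a tuple, every run with `K ≥ 1` (§4–§6): (S1ᵀ) FAILS
(exactly at `k = 0`, where `SLaw₁₂ θ P 0` is 12b's theorem); N13's 𝐑-leaf `ROpLeaf (VOfRecord₁₂ θ P)` = «`TLaw k → SLaw (k+1)`» HOLDS VACUOUSLY (a junk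
discharge of the (𝐑) slot); N11's conclusion `densitiesDescribed` FAILS, so `Dag.B14_main` at a world bound to the tuple holds IFF the node's antecedent
leaves are jointly unsatisfiable there — the Stage-11 species in miniature.  And (§5) such tuples EXIST INSIDE K0′'s CLASS MINUS UNITY: zeroing `ζ0` in ANY
tuple with `Provisos₁₂ ∧ Admissible` keeps both and violates `θ.ZtUnity` (`Σ_Y ζ0 0 Y ω = 0 ≠ 1`).  Hence the conjunct `θ.ZtUnity` of K0′–K3′ (rev 13∕15)
is NECESSARY for the N11 slot and for the 𝐑-leaf slot of `stub_nodes12` to mean print's statements: `Provisos₁₂ ∧ Admissible` alone would let K1′'s (B)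
be answered at a tuple where [III]'s Theorem p. 245 is refuted at its first step and [B16]'s Theorem 1 for 𝐑 holds about nothing.

WHAT THIS FILE PROVES (0 `sorry`, 0 `def`, standard axioms; `N`-generic).  §1 `dens_apply` ∕ `tdens_apply` (`rfl`), `integral_dens_pos`, `integral_tdens_pos`
(via `∫ρ_j = ∫𝐓ρ_k = ∫ρ₀ > 0`).  §2 `not_forall_slots_ae_zero` (`j ≤ K`), `not_forall_slotsT_ae_zero` (`k < K`).  §3 `sLaw₁₂_nonvacuous`, `tLaw₁₂_nonvacuous`:
the laws force the (2.18) ∕ (3.25) identity with law-abiding universal terms on a NON-NULL set.  §4 `TkOfRecord_succ_eq_zero_of_zeta_zero` (generic 11a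
weights), `sect2Slot_succ_eq_zero_of_zeta0_zero`, **`not_sLaw₁₂_succ_of_zeta0_zero`**, **`not_tLaw₁₂_of_zeta0_zero`**, `not_stepLaws_of_zeta0_zero` ((S1ᵀ)
fails), `rOpLeaf_VOfRecord₁₂_of_zeta0_zero` (the 𝐑-leaf holds vacuously), `not_ztUnity_of_zeta0_zero`.  §5 `provisos₁₂_zeroZeta`, `admissible_zeroZeta`,
**`exists_provisos_admissible_degenerate`** (from ANY tuple of K0′'s class without the unity conjunct).  §6 `not_densitiesDescribed_of_zeta0_zero`,
**`b14_main_iff_antecedents_false_of_zeta0_zero`** (N11 at a world bound to a degenerate tuple).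

HONEST FRAMING.  Count-neutral kernel bookkeeping about the tree's OWN Stage-12 objects (12b's dichotomy, 11a's `𝐓_k`, def-T's tower faces); a
located-species certificate and a non-vacuity certificate, NOT a discharge of N11 and NOT a refutation of K1′ (19903 carries `θ.ZtUnity`, which excludes
the species: `not_ztUnity_of_zeta0_zero`).  Nothing of Bałaban's is asserted or refuted: (S1ᵀ) = [I] Thm 1 + [II] + [III] §3 ∕ Thm 2 at the objects of
record stays the node's displayed residue.  One finite four-torus programme at fixed `ε = L^{−K}`, Bałaban AS PRINTED with locators; NOT ℝ⁴, NOT OS, NOT a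
mass gap, NOT Clay.  Sources: [III] (2.17)–(2.18) p. 257, (2.20)–(2.21) p. 258, Thm 1 p. 262, Theorem p. 245, p. 244, (3.1) p. 264, (3.16)–(3.21)
pp. 268–269, (3.24)–(3.25) p. 270; [Balaban1989LargeFieldI] (0.2)–(0.4) p. 176; [Balaban1989LargeFieldII] Thm 1 p. 355; [Balaban1985UV3] (6) p. 257.
-/

noncomputable section

open MeasureTheory
open scoped BigOperators Matrix.Norms.L2Operator

namespace Summit.QuantumFields.YangMills.Theorems.BalabanUVNodesN11FirstSlotAtRecord12

open Literature.MathematicalPhysics.QuantumFieldTheory.Balaban1983to89 T4Continuum Node00 Node00.Tk DagBinding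

variable {F : T4Family} {N : ℕ} [NeZero N]

/-! ## §1. The densities of record and their 𝐓-images ARE the χ-weighted sums of their slot families; their integrals are `∫ρ₀ > 0` -/

/-- `ρ_j` of record IS `Σ_s χ_j(s)·slot_j(s)` — the post-𝐑 slot family of record assembled (def-T's `densityOfRepr`, `rfl`).
[cite: Balaban1988Convergent, (2.18) p.257 (bookkeeping)] -/
theorem dens_apply (θ : Stage12Params F N) (P : B12.RunParams) (j : ℕ) (V : GaugeField (F.P P.K) j (SU N)) :
    densOfRecord₁₀ F N θ.toStage9Params P j V =
      ∑ s : SeqOfRecord F θ.ν θ.τ9.M (gOfRecord₁₀ F N θ.toStage9Params P) P.K j,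
        chiSeqOfRecord F N θ.ν θ.τ9.M (gOfRecord₁₀ F N θ.toStage9Params P) P.K j s V *
          slotsOfRecord F N θ.ν θ.τ9 (EOfRecord₁₀ F N θ.toStage9Params) (wOfRecord₉ F N θ.toStage9Params) θ.ppSel P
            (gOfRecord₁₀ F N θ.toStage9Params P) j s V := rfl

/-- `𝐓ρ_k` of record IS `Σ_{s′} χ_{k+1}(s′)·slotT_{k+1}(s′)` — the pre-𝐑 slot family of record assembled (`rfl`).
[cite: Balaban1988Convergent, (3.24)–(3.25) p.270 (bookkeeping)] -/
theorem tdens_apply (θ : Stage12Params F N) (P : B12.RunParams) (k : ℕ) (V : GaugeField (F.P P.K) (k + 1) (SU N)) :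
    tdensOfRecord₁₀ F N θ.toStage9Params P k V =
      ∑ s' : SeqOfRecord F θ.ν θ.τ9.M (gOfRecord₁₀ F N θ.toStage9Params P) P.K (k + 1),
        chiSeqOfRecord F N θ.ν θ.τ9.M (gOfRecord₁₀ F N θ.toStage9Params P) P.K (k + 1) s' V *
          slotsTOfRecord F N θ.ν θ.τ9 (EOfRecord₁₀ F N θ.toStage9Params) (wOfRecord₉ F N θ.toStage9Params) θ.ppSel P
            (gOfRecord₁₀ F N θ.toStage9Params P) (k + 1) s' V := rfl

/-- `∫ρ_j = ∫ρ₀` along every run, `j ≤ K` — the tower of record's (0.4) faces (`Tower.integral_eq_integral_zero`) with `ρ₀` of record.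
[cite: Balaban1985UV3, (6) p.257; Balaban1989LargeFieldI, (0.4) p.176] -/
theorem integral_dens_eq_integral_rhoZero (θ : Stage12Params F N) (h : θ.Provisos₁₂ F N) (P : B12.RunParams) (j : ℕ) (hj : j ≤ P.K) :
    ∫ V, densOfRecord₁₀ F N θ.toStage9Params P j V ∂fieldMeasure (F.P P.K) j (SU N) =
      ∫ U, rhoZeroOfRecord F N P.K P.g0 (EOfRecord₁₀ F N θ.toStage9Params P) U ∂fieldMeasure (F.P P.K) 0 (SU N) := by
  have h1 := (towerOfRecord₁₂ F N θ h).integral_eq_integral_zero P j hj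
  rw [towerOfRecord₁₂_ρ, towerOfRecord₁₂_ρ, densOfRecord₁₀_zero] at h1
  exact h1

/-- `∫𝐓ρ_k = ∫ρ₀` along every run, `k < K` — the push-forward identity at `f ≡ 1` (`Tower.integral_Trho_eq`) then (0.4).
[cite: Balaban1988Convergent, (3.1) p.264; Balaban1985UV3, (6) p.257] -/
theorem integral_tdens_eq_integral_rhoZero (θ : Stage12Params F N) (h : θ.Provisos₁₂ F N) (P : B12.RunParams) (k : ℕ) (hk : k < P.K) :
    ∫ V, tdensOfRecord₁₀ F N θ.toStage9Params P k V ∂fieldMeasure (F.P P.K) (k + 1) (SU N) =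
      ∫ U, rhoZeroOfRecord F N P.K P.g0 (EOfRecord₁₀ F N θ.toStage9Params P) U ∂fieldMeasure (F.P P.K) 0 (SU N) := by
  have h1 := (towerOfRecord₁₂ F N θ h).integral_Trho_eq P k hk
  rw [towerOfRecord₁₂_Trho, towerOfRecord₁₂_ρ] at h1
  exact h1.trans (integral_dens_eq_integral_rhoZero θ h P k hk.le)

/-- `∫ρ₀ > 0`: the Wilson start of record is positive everywhere and integrable (the tower's displayed integrability at level 0) on a probability space.
[cite: Balaban1988Convergent, Thm 1 p.262 (bookkeeping)] -/
theorem integral_rhoZero_pos (θ : Stage12Params F N) (h : θ.Provisos₁₂ F N) (P : B12.RunParams) :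
    0 < ∫ U, rhoZeroOfRecord F N P.K P.g0 (EOfRecord₁₀ F N θ.toStage9Params P) U ∂fieldMeasure (F.P P.K) 0 (SU N) := by
  haveI : IsProbabilityMeasure (fieldMeasure (F.P P.K) 0 (SU N)) := Missing.isProbabilityMeasure_fieldMeasure (F.P P.K) 0
  have hint : Integrable (rhoZeroOfRecord F N P.K P.g0 (EOfRecord₁₀ F N θ.toStage9Params P)) (fieldMeasure (F.P P.K) 0 (SU N)) := by
    have h1 := isIntegrable_towerOfRecord₁₂ F N θ h P 0 (Nat.zero_le _)
    rw [towerOfRecord₁₂_ρ, densOfRecord₁₀_zero] at h1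
    exact h1
  rw [integral_pos_iff_support_of_nonneg (fun U => (rhoZeroOfRecord_pos F N P.K P.g0 _ U).le) hint]
  have hsupp : Function.support (rhoZeroOfRecord F N P.K P.g0 (EOfRecord₁₀ F N θ.toStage9Params P)) = Set.univ :=
    Set.eq_univ_of_forall fun U => (rhoZeroOfRecord_pos F N P.K P.g0 _ U).ne'
  rw [hsupp, measure_univ]
  exact one_pos

/-- `∫ρ_j > 0` for `j ≤ K` at every Stage-12 tuple with provisos. [cite: Balaban1985UV3, (6) p.257; Balaban1988Convergent, Thm 1 p.262 (bookkeeping)] -/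
theorem integral_dens_pos (θ : Stage12Params F N) (h : θ.Provisos₁₂ F N) (P : B12.RunParams) (j : ℕ) (hj : j ≤ P.K) :
    0 < ∫ V, densOfRecord₁₀ F N θ.toStage9Params P j V ∂fieldMeasure (F.P P.K) j (SU N) := by
  rw [integral_dens_eq_integral_rhoZero θ h P j hj]
  exact integral_rhoZero_pos θ h P

/-- `∫𝐓ρ_k > 0` for `k < K` at every Stage-12 tuple with provisos. [cite: Balaban1988Convergent, (3.1) p.264 (bookkeeping)] -/
theorem integral_tdens_pos (θ : Stage12Params F N) (h : θ.Provisos₁₂ F N) (P : B12.RunParams) (k : ℕ) (hk : k < P.K) :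
    0 < ∫ V, tdensOfRecord₁₀ F N θ.toStage9Params P k V ∂fieldMeasure (F.P P.K) (k + 1) (SU N) := by
  rw [integral_tdens_eq_integral_rhoZero θ h P k hk]
  exact integral_rhoZero_pos θ h P

/-! ## §2. Some slot of every level is NON-NULL on its own χ-support -/
/-- **NOT EVERY POST-𝐑 SLOT OF LEVEL `j ≤ K` IS NULL ON ITS χ_j-SUPPORT**: otherwise `ρ_j = Σ_s χ_j(s)·slot_j(s)` would vanish a.e. and `∫ρ_j = 0 < ∫ρ₀`.
[cite: Balaban1988Convergent, (2.18) p.257; Balaban1989LargeFieldI, (0.4) p.176] -/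
theorem not_forall_slots_ae_zero (θ : Stage12Params F N) (h : θ.Provisos₁₂ F N) (P : B12.RunParams) (j : ℕ) (hj : j ≤ P.K) :
    ¬ ∀ s : SeqOfRecord F θ.ν θ.τ9.M (gOfRecord₁₀ F N θ.toStage9Params P) P.K j, ∀ᵐ V ∂(fieldMeasure (F.P P.K) j (SU N)),
      chiSeqOfRecord F N θ.ν θ.τ9.M (gOfRecord₁₀ F N θ.toStage9Params P) P.K j s V ≠ 0 →
        slotsOfRecord F N θ.ν θ.τ9 (EOfRecord₁₀ F N θ.toStage9Params) (wOfRecord₉ F N θ.toStage9Params) θ.ppSel P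
          (gOfRecord₁₀ F N θ.toStage9Params P) j s V = 0 := by
  intro hall
  have hae : ∀ᵐ V ∂(fieldMeasure (F.P P.K) j (SU N)), densOfRecord₁₀ F N θ.toStage9Params P j V = 0 := by
    filter_upwards [Filter.eventually_all.2 hall] with V hV
    rw [dens_apply]
    refine Finset.sum_eq_zero fun s _ => ?_
    by_cases hc : chiSeqOfRecord F N θ.ν θ.τ9.M (gOfRecord₁₀ F N θ.toStage9Params P) P.K j s V = 0
    · rw [hc, zero_mul]
    · rw [hV s hc, mul_zero]
  have h0 : ∫ V, densOfRecord₁₀ F N θ.toStage9Params P j V ∂fieldMeasure (F.P P.K) j (SU N) = 0 := by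
    rw [integral_congr_ae hae, integral_zero]
  exact (integral_dens_pos θ h P j hj).ne' h0

/-- **NOT EVERY PRE-𝐑 SLOT OF LEVEL `k+1`, `k < K`, IS NULL ON ITS χ_{k+1}-SUPPORT**: otherwise `𝐓ρ_k` would vanish a.e. and `∫𝐓ρ_k = 0 < ∫ρ₀`.
[cite: Balaban1988Convergent, (3.24)–(3.25) p.270, (3.1) p.264] -/
theorem not_forall_slotsT_ae_zero (θ : Stage12Params F N) (h : θ.Provisos₁₂ F N) (P : B12.RunParams) (k : ℕ) (hk : k < P.K) :
    ¬ ∀ s' : SeqOfRecord F θ.ν θ.τ9.M (gOfRecord₁₀ F N θ.toStage9Params P) P.K (k + 1), ∀ᵐ V ∂(fieldMeasure (F.P P.K) (k + 1) (SU N)),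
      chiSeqOfRecord F N θ.ν θ.τ9.M (gOfRecord₁₀ F N θ.toStage9Params P) P.K (k + 1) s' V ≠ 0 →
        slotsTOfRecord F N θ.ν θ.τ9 (EOfRecord₁₀ F N θ.toStage9Params) (wOfRecord₉ F N θ.toStage9Params) θ.ppSel P
          (gOfRecord₁₀ F N θ.toStage9Params P) (k + 1) s' V = 0 := by
  intro hall
  have hae : ∀ᵐ V ∂(fieldMeasure (F.P P.K) (k + 1) (SU N)), tdensOfRecord₁₀ F N θ.toStage9Params P k V = 0 := by
    filter_upwards [Filter.eventually_all.2 hall] with V hV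
    rw [tdens_apply]
    refine Finset.sum_eq_zero fun s' _ => ?_
    by_cases hc : chiSeqOfRecord F N θ.ν θ.τ9.M (gOfRecord₁₀ F N θ.toStage9Params P) P.K (k + 1) s' V = 0
    · rw [hc, zero_mul]
    · rw [hV s' hc, mul_zero]
  have h0 : ∫ V, tdensOfRecord₁₀ F N θ.toStage9Params P k V ∂fieldMeasure (F.P P.K) (k + 1) (SU N) = 0 := by
    rw [integral_congr_ae hae, integral_zero]
  exact (integral_tdens_pos θ h P k hk).ne' h0

/-! ## §3. The laws of record, when they hold, hold THROUGH THE IDENTITY BRANCH ON A NON-NULL SET -/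
/-- **`SLaw₁₂ θ P j` IS CONTENTFUL** (`j ≤ K`): it yields law-abiding universal term values AND a sequence `s` whose post-𝐑 slot is non-null on its
χ_j-support and satisfies the (2.18) identity `slot_j(s) = 𝐓_j(s) exp A_j(s)` there a.e. — the zero branch of 12b's dichotomy never discharges a whole level.
[cite: Balaban1988Convergent, (2.18) p.257, (2.23) p.258, Thm 1 p.262] -/
theorem sLaw₁₂_nonvacuous (θ : Stage12Params F N) (h : θ.Provisos₁₂ F N) (P : B12.RunParams) (j : ℕ) (hj : j ≤ P.K) (hS : SLaw₁₂ F N θ P j) :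
    ∃ (t : SeqOfRecord F θ.ν θ.τ9.M (gOfRecord₁₀ F N θ.toStage9Params P) P.K j → Sect2.TermValues (F.P P.K) (MatA N) (FluctV N) θ.τ9.M)
      (Ek : SeqOfRecord F θ.ν θ.τ9.M (gOfRecord₁₀ F N θ.toStage9Params P) P.K j → ℝ)
      (s : SeqOfRecord F θ.ν θ.τ9.M (gOfRecord₁₀ F N θ.toStage9Params P) P.K j),
      Sect2.UniversalE t ∧
      (∀ s₁, Sect2.LawsRT (sect2TowerOfRecord F N (FluctV N) P.K (settingOfRecord₁₂ F N θ P) (θ.Rz P.K) s₁ (t s₁)) (settingOfRecord₁₂ F N θ P).lf j) ∧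
      (∀ᵐ V ∂(fieldMeasure (F.P P.K) j (SU N)),
        chiSeqOfRecord F N θ.ν θ.τ9.M (gOfRecord₁₀ F N θ.toStage9Params P) P.K j s V ≠ 0 →
          slotsOfRecord F N θ.ν θ.τ9 (EOfRecord₁₀ F N θ.toStage9Params) (wOfRecord₉ F N θ.toStage9Params) θ.ppSel P
              (gOfRecord₁₀ F N θ.toStage9Params P) j s V =
            sect2Slot F N (FluctV N) P.K (settingOfRecord₁₂ F N θ P) (θ.Rz P.K) (WtOfRecord₁₂ F N θ P) s (t s) (Ek s)
              (UbgOfRecord₁₂ F N θ P j s) V) ∧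
      ¬ ∀ᵐ V ∂(fieldMeasure (F.P P.K) j (SU N)),
        chiSeqOfRecord F N θ.ν θ.τ9.M (gOfRecord₁₀ F N θ.toStage9Params P) P.K j s V ≠ 0 →
          slotsOfRecord F N θ.ν θ.τ9 (EOfRecord₁₀ F N θ.toStage9Params) (wOfRecord₉ F N θ.toStage9Params) θ.ppSel P
            (gOfRecord₁₀ F N θ.toStage9Params P) j s V = 0 := by
  obtain ⟨t, Ek, hu, hs⟩ := (sLaw₁₂_iff F N θ P j).1 hS
  obtain ⟨s, hs'⟩ : ∃ s, ¬ _ := not_forall.1 (not_forall_slots_ae_zero θ h P j hj)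
  refine ⟨t, Ek, s, hu, fun s₁ => (hs s₁).1, ?_, hs'⟩
  rcases (hs s).2 with h0 | hid
  · exact absurd (Filter.Eventually.of_forall fun V _ => by rw [h0]; rfl) hs'
  · exact hid

/-- **`TLaw₁₂ θ P k` IS CONTENTFUL** (`k < K`): it yields law-abiding universal term values (`Sect2.LawsT … k`) AND a sequence `s′` whose pre-𝐑 slot is
non-null on its χ_{k+1}-support and satisfies the (3.25) identity `slotT_{k+1}(s′) = 𝐓_{k+1}(s′) exp A_{k+1}(s′)` there a.e. — at `k = 0` this is
[I]'s Theorem 1 (the first small-field step) genuinely demanded of N11's first slot at every Stage-12 tuple with provisos.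
[cite: Balaban1988Convergent, Theorem p.245, (3.25) p.270, §2 p.262; Balaban1987RG1, Thm 1 p.259] -/
theorem tLaw₁₂_nonvacuous (θ : Stage12Params F N) (h : θ.Provisos₁₂ F N) (P : B12.RunParams) (k : ℕ) (hk : k < P.K) (hT : TLaw₁₂ F N θ P k) :
    ∃ (t : SeqOfRecord F θ.ν θ.τ9.M (gOfRecord₁₀ F N θ.toStage9Params P) P.K (k + 1) → Sect2.TermValues (F.P P.K) (MatA N) (FluctV N) θ.τ9.M)
      (Ek : SeqOfRecord F θ.ν θ.τ9.M (gOfRecord₁₀ F N θ.toStage9Params P) P.K (k + 1) → ℝ)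
      (s' : SeqOfRecord F θ.ν θ.τ9.M (gOfRecord₁₀ F N θ.toStage9Params P) P.K (k + 1)),
      Sect2.UniversalE t ∧
      (∀ s₁, Sect2.LawsT (sect2TowerOfRecord F N (FluctV N) P.K (settingOfRecord₁₂ F N θ P) (θ.Rz P.K) s₁ (t s₁))
        (settingOfRecord₁₂ F N θ P).lf (settingOfRecord₁₂ F N θ P).βc k) ∧
      (∀ᵐ V ∂(fieldMeasure (F.P P.K) (k + 1) (SU N)),
        chiSeqOfRecord F N θ.ν θ.τ9.M (gOfRecord₁₀ F N θ.toStage9Params P) P.K (k + 1) s' V ≠ 0 →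
          slotsTOfRecord F N θ.ν θ.τ9 (EOfRecord₁₀ F N θ.toStage9Params) (wOfRecord₉ F N θ.toStage9Params) θ.ppSel P
              (gOfRecord₁₀ F N θ.toStage9Params P) (k + 1) s' V =
            sect2Slot F N (FluctV N) P.K (settingOfRecord₁₂ F N θ P) (θ.Rz P.K) (WtOfRecord₁₂ F N θ P) s' (t s') (Ek s')
              (UbgOfRecord₁₂ F N θ P (k + 1) s') V) ∧
      ¬ ∀ᵐ V ∂(fieldMeasure (F.P P.K) (k + 1) (SU N)),
        chiSeqOfRecord F N θ.ν θ.τ9.M (gOfRecord₁₀ F N θ.toStage9Params P) P.K (k + 1) s' V ≠ 0 →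
          slotsTOfRecord F N θ.ν θ.τ9 (EOfRecord₁₀ F N θ.toStage9Params) (wOfRecord₉ F N θ.toStage9Params) θ.ppSel P
            (gOfRecord₁₀ F N θ.toStage9Params P) (k + 1) s' V = 0 := by
  obtain ⟨t, Ek, hu, hs⟩ := (tLaw₁₂_iff F N θ P k).1 hT
  obtain ⟨s', hs'⟩ : ∃ s', ¬ _ := not_forall.1 (not_forall_slotsT_ae_zero θ h P k hk)
  refine ⟨t, Ek, s', hu, fun s₁ => (hs s₁).1, ?_, hs'⟩
  rcases (hs s').2 with h0 | hid
  · exact absurd (Filter.Eventually.of_forall fun V _ => by rw [h0]; rfl) hs'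
  · exact hid

/-! ## §4. The (S3) species in kernel: degenerate generation-0 𝐓-weights make every positive-level §2 slot the zero density -/
section ZetaZero

/-- One generation of record applied to the ZERO operand is zero (the A-integral of `w·0`, times `ζ`, transported by the kernel of record: `∫0 = 0`); the
`DecidableEq` instance is an implicit binder (unified with 11a's classical one, not synthesised).
[cite: Balaban1988Convergent, (2.21) p.258 (bookkeeping)] -/
theorem genOp_genDataOfRecord_of_eq_zero (V : Type) [NormedAddCommGroup V] [InnerProductSpace ℝ V] [FiniteDimensional ℝ V] [MeasurableSpace V]
    [BorelSpace V] (ν : Stage7Numerics) (M : ℕ) (g : ℕ → ℝ) (K : ℕ) (W : TkWeights F N V K) {k : ℕ} (s : SeqOfRecord F ν M g K k)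
    (S : ℕ → Set (Site (F.P K) 0)) (j : ℕ) {_ : DecidableEq (PBond (F.P K) j)} {Φ : MultiCfg (F.P K) (SU N) V → ℝ} (hΦ : ∀ ω, Φ ω = 0)
    (ω : MultiCfg (F.P K) (SU N) V) : genOp j (genDataOfRecord F N V ν M g K W s S j) Φ ω = 0 := by
  rw [genOp_apply, vOp_apply]
  have hA : ∀ ω', aOp j (genDataOfRecord F N V ν M g K W s S j).sA (genDataOfRecord F N V ν M g K W s S j).w Φ ω' = 0 := fun ω' => by
    rw [aOp_apply]; simp only [hΦ, mul_zero, integral_zero]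
  simp only [zetaOp_apply, hA, mul_zero]
  change kernelRTOfRecord F N K j _ _ (fun _ => (0 : ℝ)) _ = 0
  rw [kernelRTOfRecord, kernelRT_const, mul_zero]

/-- **Every branch operator `𝐓_{i+1}(s, S)` of record is the ZERO operator when `ζ_0 ≡ 0`**: the innermost generation multiplies by `ζ_0 = 0` before
transporting ((2.20): the newest generation acts last, generation 0 first), later generations act on the zero function. [cite: Balaban1988Convergent, (2.20)–(2.21) p.258, (3.24) p.270 (bookkeeping)] -/
theorem tkBranchOfRecord_succ_eq_zero_of_zeta_zero (V : Type) [NormedAddCommGroup V] [InnerProductSpace ℝ V] [FiniteDimensional ℝ V]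
    [MeasurableSpace V] [BorelSpace V] (ν : Stage7Numerics) (M : ℕ) (g : ℕ → ℝ) (K : ℕ) (W : TkWeights F N V K)
    (hW : ∀ Y ω, W.ζ 0 Y ω = 0) {k : ℕ} (s : SeqOfRecord F ν M g K k) (S : ℕ → Set (Site (F.P K) 0)) :
    ∀ (i : ℕ) (Φ : MultiCfg (F.P K) (SU N) V → ℝ) (ω : MultiCfg (F.P K) (SU N) V), tkBranchOfRecord F N V ν M g K W s S (i + 1) Φ ω = 0
  | 0, Φ, ω => by
      rw [tkBranchOfRecord_succ, genOp_apply, vOp_apply]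
      simp only [genDataOfRecord, zetaOp_apply, hW, zero_mul]
      rw [kernelRTOfRecord, kernelRT_const, mul_zero]
  | i + 1, Φ, ω => by
      rw [tkBranchOfRecord_succ]
      exact genOp_genDataOfRecord_of_eq_zero V ν M g K W s S (i + 1)
        (tkBranchOfRecord_succ_eq_zero_of_zeta_zero V ν M g K W hW s S i Φ) ω

/-- **11a's `𝐓_{k+1}(s)` OF RECORD IS THE ZERO OPERATOR WHEN `ζ_0 ≡ 0`** (generic weight datum, every operand, every positive level).
[cite: Balaban1988Convergent, (2.18) p.257, (2.20)–(2.21) p.258 (bookkeeping)] -/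
theorem TkOfRecord_succ_eq_zero_of_zeta_zero (V : Type) [NormedAddCommGroup V] [InnerProductSpace ℝ V] [FiniteDimensional ℝ V]
    [MeasurableSpace V] [BorelSpace V] (ν : Stage7Numerics) (M : ℕ) (g : ℕ → ℝ) (K : ℕ) (W : TkWeights F N V K)
    (hW : ∀ Y ω, W.ζ 0 Y ω = 0) (k : ℕ) (s : SeqOfRecord F ν M g K (k + 1))
    (Φ : SFluct (F.P K) V → B15DeterminingSets.MSField (F.P K) (SU N) → ℝ) (V' : GaugeField (F.P K) (k + 1) (SU N)) :
    TkOfRecord F N V ν M g K W (k + 1) s Φ V' = 0 := by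
  rw [TkOfRecord_apply]
  exact Finset.sum_eq_zero fun S _ => tkBranchOfRecord_succ_eq_zero_of_zeta_zero V ν M g K W hW s S k _ _

/-- The 𝐓-weights of record of the run inherit a vanishing generation-0 `ζ` from a vanishing residual factor `ζ0` (`ζ = ζ0 · χreg`, 12a).
[cite: Balaban1988Convergent, (2.21) p.258, p.267 (bookkeeping)] -/
theorem WtOfRecord₁₂_zeta_zero_of_zeta0_zero (θ : Stage12Params F N) (P : B12.RunParams)
    (hζ : ∀ Y ω, (θ.Zt P.K).ζ0 0 Y ω = 0) : ∀ Y ω, (WtOfRecord₁₂ F N θ P).ζ 0 Y ω = 0 := by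
  intro Y ω
  show zetaWt F N (FluctV N) θ.ν θ.s2.cR P (gOfRecord₁₀ F N θ.toStage9Params P) (θ.Zt P.K) 0 Y ω = 0
  rw [zetaWt, hζ, zero_mul]

/-- **AT A TUPLE WHOSE RESIDUAL 𝐓-WEIGHT FACTOR VANISHES AT GENERATION 0, EVERY §2-FORM SLOT `𝐓_{k+1}(s) exp A_{k+1}(s)` OF RECORD IS THE ZERO DENSITY** —
for every sequence, every term-value witness, every constant, every background map. [cite: Balaban1988Convergent, (2.18) p.257, (2.23) p.258 (bookkeeping)] -/
theorem sect2Slot_succ_eq_zero_of_zeta0_zero (θ : Stage12Params F N) (P : B12.RunParams) (hζ : ∀ Y ω, (θ.Zt P.K).ζ0 0 Y ω = 0) (k : ℕ)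
    (s : SeqOfRecord F θ.ν θ.τ9.M (gOfRecord₁₀ F N θ.toStage9Params P) P.K (k + 1))
    (t : Sect2.TermValues (F.P P.K) (MatA N) (FluctV N) θ.τ9.M) (Ek : ℝ) (U : BgMap F N P.K) :
    sect2Slot F N (FluctV N) P.K (settingOfRecord₁₂ F N θ P) (θ.Rz P.K) (WtOfRecord₁₂ F N θ P) s t Ek U = 0 := by
  funext V
  exact TkOfRecord_succ_eq_zero_of_zeta_zero (FluctV N) θ.ν θ.τ9.M _ P.K _ (WtOfRecord₁₂_zeta_zero_of_zeta0_zero θ P hζ) k s _ V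

/-- **`SLaw₁₂ θ P (j+1)` FAILS for `j + 1 ≤ K` at such a tuple**: both branches of the dichotomy would make every post-𝐑 slot of level `j+1` null on its
χ-support, against §2. [cite: Balaban1988Convergent, (2.18) p.257, Thm 1 p.262; Balaban1989LargeFieldI, (0.4) p.176 (located species, bookkeeping)] -/
theorem not_sLaw₁₂_succ_of_zeta0_zero (θ : Stage12Params F N) (h : θ.Provisos₁₂ F N) (P : B12.RunParams) (j : ℕ) (hj : j + 1 ≤ P.K)
    (hζ : ∀ Y ω, (θ.Zt P.K).ζ0 0 Y ω = 0) : ¬ SLaw₁₂ F N θ P (j + 1) := by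
  intro hS
  obtain ⟨t, Ek, s, -, -, hid, hne⟩ := sLaw₁₂_nonvacuous θ h P (j + 1) hj hS
  apply hne
  filter_upwards [hid] with V hV hχ
  rw [hV hχ, sect2Slot_succ_eq_zero_of_zeta0_zero θ P hζ]
  rfl

/-- **`TLaw₁₂ θ P k` FAILS for every `k < K` at such a tuple** — in particular N11's FIRST slot `TLaw₁₂ θ P 0` (the 𝐓-image of `ρ₀`) fails on every run with
`K ≥ 1`: the (S3) species of dag-ref-H's `Record12` sweep, in kernel. [cite: Balaban1988Convergent, Theorem p.245, (3.25) p.270 (located species, bookkeeping)] -/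
theorem not_tLaw₁₂_of_zeta0_zero (θ : Stage12Params F N) (h : θ.Provisos₁₂ F N) (P : B12.RunParams) (k : ℕ) (hk : k < P.K)
    (hζ : ∀ Y ω, (θ.Zt P.K).ζ0 0 Y ω = 0) : ¬ TLaw₁₂ F N θ P k := by
  intro hT
  obtain ⟨t, Ek, s', -, -, hid, hne⟩ := tLaw₁₂_nonvacuous θ h P k hk hT
  apply hne
  filter_upwards [hid] with V hV hχ
  rw [hV hχ, sect2Slot_succ_eq_zero_of_zeta0_zero θ P hζ]
  rfl

/-- **(S1ᵀ) — [III]'s Theorem of p. 245 at the objects of record — FAILS at such a tuple on every run with `K ≥ 1`**, exactly at `k = 0` (`SLaw₁₂ θ P 0`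
is 12b's theorem `sLaw₁₂_zero`, `TLaw₁₂ θ P 0` is false). [cite: Balaban1988Convergent, Theorem p.245, Thm 1 p.262 (located species, bookkeeping)] -/
theorem not_stepLaws_of_zeta0_zero (θ : Stage12Params F N) (h : θ.Provisos₁₂ F N) (P : B12.RunParams) (hK : 0 < P.K)
    (hζ : ∀ Y ω, (θ.Zt P.K).ζ0 0 Y ω = 0) : ¬ ∀ k, k < P.K → SLaw₁₂ F N θ P k → TLaw₁₂ F N θ P k :=
  fun hST => not_tLaw₁₂_of_zeta0_zero θ h P 0 hK hζ (hST 0 hK (sLaw₁₂_zero F N θ P))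

/-- **THE 𝐑-LEAF OF RECORD HOLDS VACUOUSLY at such a tuple**: `ROpLeaf (VOfRecord₁₂ θ P)` = «`∀ k < K, TLaw₁₂ θ P k → SLaw₁₂ θ P (k+1)`»
(`rOpLeaf_VOfRecord₁₂_iff`) and every hypothesis `TLaw₁₂ θ P k` is false — a JUNK discharge of N13's (𝐑) slot ([Balaban1989LargeFieldII] Thm 1 for 𝐑 about
nothing). [cite: Balaban1988Convergent, p.244, Thm 2 p.263; Balaban1989LargeFieldII, Thm 1 p.355 (located species, bookkeeping)] -/
theorem rOpLeaf_VOfRecord₁₂_of_zeta0_zero (θ : Stage12Params F N) (h : θ.Provisos₁₂ F N) (P : B12.RunParams)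
    (hζ : ∀ Y ω, (θ.Zt P.K).ζ0 0 Y ω = 0) : ROpLeaf (VOfRecord₁₂ F N θ P) :=
  (rOpLeaf_VOfRecord₁₂_iff F N θ P).2 fun k hk hT => absurd hT (not_tLaw₁₂_of_zeta0_zero θ h P k hk hζ)

/-- **SUCH TUPLES VIOLATE PRINT'S PARTITION OF UNITY** `θ.ZtUnity` (`Σ_Y ζ0 0 Y ω = 0 ≠ 1` on the run's torus) — the conjunct of K0′–K3′ (rev 13∕15) that
excludes the species. [cite: Balaban1988Convergent, (3.16)–(3.20) pp.268–269 (bookkeeping)] -/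
theorem not_ztUnity_of_zeta0_zero (θ : Stage12Params F N) (K : ℕ) (hζ : ∀ Y ω, (θ.Zt K).ζ0 0 Y ω = 0) : ¬ θ.ZtUnity F N := by
  intro hU
  have h1 := hU K 0 (baseCfg 0 1)
  simp only [hζ, finsum_zero] at h1
  exact zero_ne_one h1

end ZetaZero

/-! ## §5. Degenerate tuples INSIDE K0′'s class minus unity: zeroing `ζ0` keeps `Provisos₁₂` and `Admissible` -/
section Transfer

/-- Zeroing the residual factor `ζ0` (keeping `quad`) PRESERVES THE DISPLAYED PROVISOS: `base`, `rzLaws`, `bg` do not read `Zt`; `ztLaws` (`0 ≤ 0`) and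
`ztLocal` (a constant is local) hold. [cite: Balaban1988Convergent, (2.21) p.258, (2.28) p.259, p.267 (bookkeeping: the typed provisos)] -/
theorem provisos₁₂_zeroZeta (θ : Stage12Params F N) (h : θ.Provisos₁₂ F N) :
    ({ θ with Zt := fun K => ⟨fun _ _ _ => 0, (θ.Zt K).quad⟩ } : Stage12Params F N).Provisos₁₂ F N where
  base := h.base
  rzLaws := h.rzLaws
  ztLaws := fun _ => ⟨fun _ _ _ => le_rfl⟩
  ztLocal := fun _ => ⟨by intros; rfl⟩  -- arity-robust under both rows of `zeta0_local` (W2 of the FLAG №1 R2b cure, dag-n11-d 2026-08-29)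
  bg := h.bg

/-- … and PRESERVES ADMISSIBILITY (no sign clause reads a residual object). [cite: Balaban1988Convergent, (2.10) p.256, (2.34)–(2.39) p.261 (bookkeeping)] -/
theorem admissible_zeroZeta (θ : Stage12Params F N) (hθ : θ.Admissible F N) :
    ({ θ with Zt := fun K => ⟨fun _ _ _ => 0, (θ.Zt K).quad⟩ } : Stage12Params F N).Admissible F N :=
  hθ

/-- **FROM ANY TUPLE OF K0′'s CLASS WITHOUT THE UNITY CONJUNCT, A DEGENERATE ONE**: for every `θ` with `Provisos₁₂ ∧ Admissible` there is `θ′` over the SAME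
Stage-9 part (same datum letters: histories, `χ`'s, step weights, selector, backgrounds) with `Provisos₁₂ ∧ Admissible`, VIOLATING `ZtUnity`, at which on
every run with `K ≥ 1`: N11's first slot `TLaw₁₂ θ′ P 0` and (S1ᵀ) FAIL, every positive-level `SLaw₁₂` fails, and the 𝐑-leaf holds vacuously.  Hence
`Provisos₁₂ ∧ Admissible` ALONE do not make the N11 ∕ N13 slots of `stub_nodes12` mean print's statements; the guard `θ.ZtUnity` of stmt-QuantumFields-19903
is load-bearing. [cite: Balaban1988Convergent, Theorem p.245, Thm 1 p.262, (3.16)–(3.20) pp.268–269; Balaban1989LargeFieldII, Thm 1 p.355 (located species, bookkeeping)] -/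
theorem exists_provisos_admissible_degenerate (θ : Stage12Params F N) (h : θ.Provisos₁₂ F N) (hθ : θ.Admissible F N) :
    ∃ (θ' : Stage12Params F N) (_ : θ'.Provisos₁₂ F N), θ'.toStage9Params = θ.toStage9Params ∧ θ'.Admissible F N ∧ ¬ θ'.ZtUnity F N ∧
      ∀ P : B12.RunParams, 0 < P.K →
        ¬ TLaw₁₂ F N θ' P 0 ∧ (¬ ∀ k, k < P.K → SLaw₁₂ F N θ' P k → TLaw₁₂ F N θ' P k) ∧
          (∀ j, j + 1 ≤ P.K → ¬ SLaw₁₂ F N θ' P (j + 1)) ∧ ROpLeaf (VOfRecord₁₂ F N θ' P) :=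
  ⟨{ θ with Zt := fun K => ⟨fun _ _ _ => 0, (θ.Zt K).quad⟩ }, provisos₁₂_zeroZeta θ h, rfl, admissible_zeroZeta θ hθ,
    not_ztUnity_of_zeta0_zero _ 0 (fun _ _ => rfl),
    fun P hK => ⟨not_tLaw₁₂_of_zeta0_zero _ (provisos₁₂_zeroZeta θ h) P 0 hK (fun _ _ => rfl),
      not_stepLaws_of_zeta0_zero _ (provisos₁₂_zeroZeta θ h) P hK (fun _ _ => rfl),
      fun j hj => not_sLaw₁₂_succ_of_zeta0_zero _ (provisos₁₂_zeroZeta θ h) P j hj (fun _ _ => rfl),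
      rOpLeaf_VOfRecord₁₂_of_zeta0_zero _ (provisos₁₂_zeroZeta θ h) P (fun _ _ => rfl)⟩⟩

end Transfer

/-! ## §6. N11 at a world bound to a degenerate tuple: its conclusion fails at every run with `K ≥ 1` -/
section Node

variable (θ : Stage12Params F N) (h : θ.Provisos₁₂ F N) (w : WorldP) (P : B12.RunParams)

/-- **N11's CONCLUSION `densitiesDescribed` FAILS at a degenerate tuple** on every run with `K ≥ 1` (it reads `SLaw₁₂ θ P 1`, this seat's
`densitiesDescribed_iff_sLaw₁₂`). [cite: Balaban1988Convergent, Thm 1 p.262 (located species, bookkeeping)] -/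
theorem not_densitiesDescribed_of_zeta0_zero (hC : w.C = (datumOfRecord₁₂ F N θ h).C) (hK : 0 < P.K) (hζ : ∀ Y ω, (θ.Zt P.K).ζ0 0 Y ω = 0) :
    ¬ (leavesP w P).densitiesDescribed := fun hd =>
  not_sLaw₁₂_succ_of_zeta0_zero θ h P 0 hK hζ
    ((BalabanUVNodesN11AtRecord12C.densitiesDescribed_iff_sLaw₁₂ F N θ h w P hC).1 hd 1 hK)

/-- **N11 AT A WORLD BOUND TO A DEGENERATE TUPLE HOLDS IFF ITS ANTECEDENTS ARE JOINTLY UNSATISFIABLE THERE** (runs with `K ≥ 1`): the (𝐑) hypothesis holds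
vacuously, the conclusion fails — the Stage-11 species (`BalabanUVNodesN11AtRecord11Vacuity.b14_main_iff_antecedents_false`) in miniature, now EXCLUDED by the
item's guard `θ.ZtUnity` (`not_ztUnity_of_zeta0_zero`). [cite: Balaban1988Convergent, Thm 1 p.262, Theorem p.245, p.244 (located species, bookkeeping)] -/
theorem b14_main_iff_antecedents_false_of_zeta0_zero (hC : w.C = (datumOfRecord₁₂ F N θ h).C)
    (hup : w.up P = upOfRecord₅C F N (θ.toStage5₁₂ F N) P) (hK : 0 < P.K) (hζ : ∀ Y ω, (θ.Zt P.K).ζ0 0 Y ω = 0) :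
    Dag.B14_main (leavesP w P) ↔
      ¬ ((leavesP w P).b7 ∧ (leavesP w P).b8 ∧ (leavesP w P).b9 ∧ (leavesP w P).b10 ∧ (leavesP w P).b11 ∧
          ((leavesP w P).smallCouplings → (leavesP w P).smallFieldInductive) ∧
          ((leavesP w P).smallCouplings → (leavesP w P).flowControl) ∧ (leavesP w P).smallCouplings) := by
  rw [BalabanUVNodesN11AtRecord12C.b14_main_iff_at_record₁₂ F N θ h w P hC hup]
  have hR : ∀ k, k < P.K → TLaw₁₂ F N θ P k → SLaw₁₂ F N θ P (k + 1) :=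
    (rOpLeaf_VOfRecord₁₂_iff F N θ P).1 (rOpLeaf_VOfRecord₁₂_of_zeta0_zero θ h P hζ)
  have hS : ¬ ∀ k, k ≤ P.K → SLaw₁₂ F N θ P k := fun hall => not_sLaw₁₂_succ_of_zeta0_zero θ h P 0 hK hζ (hall 1 hK)
  constructor
  · rintro hN ⟨h7, h8, h9, h10, h11, hsf, hfc, hsc⟩
    exact hS (hN h7 h8 h9 h10 h11 hsf hfc hR hsc)
  · intro hnot h7 h8 h9 h10 h11 hsf hfc _ hsc
    exact absurd ⟨h7, h8, h9, h10, h11, hsf, hfc, hsc⟩ hnot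

end Node

end Summit.QuantumFields.YangMills.Theorems.BalabanUVNodesN11FirstSlotAtRecord12

end
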